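import Summits.CriticalPhenomena.CardyFormulaZ2.Theorems.CardyComplexConeEdgePrecompactUFRSExteriorWinding
import Summits.CriticalPhenomena.CardyFormulaZ2.Theorems.CardyComplexConeEdgePrecompactUFRSTwoArcExcursion

/-!
# Winding numbers of ribbons and of far-away chains
(line `qkz-strip-boundary-arm` of crux `CardyComplexCone.EdgePrecompact`, stmt-CriticalPhenomena-11387;
lattice tools for the START-pair residual of `ufrs_initialContactCase_certJ` / `ufrs_slippedReturnCase_certJ`)

Pure lattice facts about the winding number `MedialTrail.dwnd` of chains of unit steps:

* `dartWnd_eq_zero_of_lt_ST`, `dartWnd_eq_zero_of_le_ST`: a step contributes at the face `F` only if its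
  lower end is on the row of `F`;
* `dwnd_eq_zero_of_box_ST`: a closed chain inside a box does not wind around a face outside the box (from the
  four-quadrant lemma `closedChain_quadrants_SR`);
* `dwnd_ribbon_ST` (registered anchor `openArc_ribbon_ST`): THE RIBBON LEMMA. For a unit-step path
  `ζ 0, …, ζ L`, a lattice vector `h H` joined to `0` by a unit-step path `h 0 = 0, …, h H`, the closed chain
  "`ζ` forward, the hop `ζ L + h ·`, the translate `ζ · + h H` backward, the hop `ζ 0 + h ·` backward" has
  winding number `0` at every face farther than `H + 2` (in the sup norm) from all `ζ i`: it is the sum of the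
  `L` elementary closed chains "one step, hop, translated step back, hop back", each inside a box of radius
  `H + 1` around `ζ i`.

References: H. Hopf, Compositio Math. 2 (1935), §1 (Umlaufzahl of sums of closed polygons).
(buildfix 2026-08-20: comment-only re-land to re-enqueue the module build after its blocking imports were repaired; no declaration changed.)
-/

namespace Summit.CriticalPhenomena.CardyFormulaZ2.Cruxes.EdgePrecompact.QkzStripBoundaryArm

open Literature.Probability.LatticeModels Literature.Probability.LatticeModels.MedialTrail
open scoped BigOperators

/-! ## Support of a single step -/

/-- A step contributes to the winding number at `F` only if its lower end is on the row of `F` and it is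
not east of `F`. -/
theorem dartWnd_ne_zero_ST {d : Pt × Pt} {F : Pt} (h : dartWnd d F ≠ 0) :
    d.2.1 = d.1.1 ∧ d.1.1 ≤ F.1 ∧ ((d.1.2 = F.2 ∧ d.2.2 = F.2 + 1) ∨ (d.2.2 = F.2 ∧ d.1.2 = F.2 + 1)) := by
  unfold dartWnd at h
  split_ifs at h with h1 h2 <;> first | exact absurd rfl h | omega

/-- A step strictly above the row of `F` does not contribute. -/
theorem dartWnd_eq_zero_of_lt_ST {d : Pt × Pt} {F : Pt} (h1 : F.2 < d.1.2) (h2 : F.2 < d.2.2) : dartWnd d F = 0 := by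
  by_contra h; have := dartWnd_ne_zero_ST h; omega

/-- A step weakly below the row above `F` does not contribute. -/
theorem dartWnd_eq_zero_of_le_ST {d : Pt × Pt} {F : Pt} (h1 : d.1.2 ≤ F.2) (h2 : d.2.2 ≤ F.2) : dartWnd d F = 0 := by
  by_contra h; have := dartWnd_ne_zero_ST h; omega

/-- A step east of `F` does not contribute. -/
theorem dartWnd_eq_zero_of_fst_lt_ST {d : Pt × Pt} {F : Pt} (h1 : F.1 < d.1.1) : dartWnd d F = 0 := by
  by_contra h; have := dartWnd_ne_zero_ST h; omega

/-- A list of non-contributing steps has winding number `0`. -/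
theorem dwnd_eq_zero_of_forall_ST {D : List (Pt × Pt)} {F : Pt} (h : ∀ d ∈ D, dartWnd d F = 0) : dwnd D F = 0 := by
  unfold dwnd
  rw [List.sum_eq_zero]
  intro x hx
  rw [List.mem_map] at hx
  obtain ⟨d, hd, rfl⟩ := hx
  exact h d hd

/-! ## Closed chains in a box -/

/-- **A closed chain inside a box does not wind around a face outside the box.** -/
theorem dwnd_eq_zero_of_box_ST (D : List (Pt × Pt)) (F c : Pt) (R : ℤ)
    (hD : ∀ d ∈ D, IsUnitStep d.1 d.2 ∨ d.1 = d.2) (hK : ∀ g : Pt → ℤ, (D.map fun d => g d.2 - g d.1).sum = 0)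
    (hbox : ∀ d ∈ D, |d.1.1 - c.1| ≤ R ∧ |d.1.2 - c.2| ≤ R) (hfar : R + 1 ≤ |F.1 - c.1| ∨ R + 1 ≤ |F.2 - c.2|) :
    dwnd D F = 0 := by
  by_contra hw
  obtain ⟨⟨d₁, hd₁, q₁⟩, ⟨d₂, hd₂, q₂⟩, ⟨d₃, hd₃, q₃⟩, ⟨d₄, hd₄, q₄⟩⟩ := closedChain_quadrants_SR D F hD hK hw
  have b₁ := hbox d₁ hd₁; have b₂ := hbox d₂ hd₂; have b₃ := hbox d₃ hd₃; have b₄ := hbox d₄ hd₄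
  simp only [abs_le] at b₁ b₂ b₃ b₄
  rcases hfar with h | h <;> rw [le_abs] at h <;> rcases h with h | h <;> omega

/-! ## Unit-step paths stay in a box -/

/-- A unit-step path from the origin stays within sup-distance `k` after `k` steps. -/
theorem unitPath_bound_ST (h : ℕ → Pt) (H : ℕ) (h0 : h 0 = 0) (hh : ∀ k < H, IsUnitStep (h k) (h (k + 1))) :
    ∀ k ≤ H, |(h k).1| ≤ k ∧ |(h k).2| ≤ k := by
  intro k
  induction k with
  | zero => intro _; rw [h0]; simp
  | succ k ih =>
    intro hk
    obtain ⟨i1, i2⟩ := ih (by omega)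
    have hs := hh k (by omega)
    simp only [IsUnitStep] at hs
    rw [abs_le] at i1 i2
    constructor <;> rw [abs_le] <;> push_cast <;> omega

/-! ## The ribbon lemma -/

/-- `fwdPiece` with one more step. -/
theorem fwdPiece_succ_ST (P : ℕ → Pt) (m L : ℕ) : fwdPiece P m (L + 1) = fwdPiece P m L ++ [(P (m + L), P (m + L + 1))] := by
  simp [fwdPiece, List.range_succ]

/-- `bwdPiece` with one more step. -/
theorem bwdPiece_succ_ST (P : ℕ → Pt) (m L : ℕ) : bwdPiece P m (L + 1) = bwdPiece P m L ++ [(P (m + L + 1), P (m + L))] := by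
  simp [bwdPiece, List.range_succ]

/-- The backward piece has the opposite winding number of the forward piece (unit steps). -/
theorem dwnd_bwdPiece_eq_neg_ST (P : ℕ → Pt) (m L : ℕ) (F : Pt) (hP : ∀ k < L, IsUnitStep (P (m + k)) (P (m + k + 1))) :
    dwnd (bwdPiece P m L) F = -dwnd (fwdPiece P m L) F := by
  rw [dwnd_bwdPiece_SR P m L F hP, dwnd_fwdPiece_SR]

/-- **The ribbon lemma** (see the module docstring). -/
theorem dwnd_ribbon_ST (ζ h : ℕ → Pt) (H : ℕ) (F : Pt) (h0 : h 0 = 0) (hh : ∀ k < H, IsUnitStep (h k) (h (k + 1))) :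
    ∀ L, (∀ i < L, IsUnitStep (ζ i) (ζ (i + 1))) → (∀ i ≤ L, (H : ℤ) + 3 ≤ |F.1 - (ζ i).1| ∨ (H : ℤ) + 3 ≤ |F.2 - (ζ i).2|) →
      dwnd (fwdPiece ζ 0 L ++ fwdPiece (fun k => ζ L + h k) 0 H ++ bwdPiece (fun i => ζ i + h H) 0 L ++
        bwdPiece (fun k => ζ 0 + h k) 0 H) F = 0 := by
  have hb := unitPath_bound_ST h H h0 hh
  have hhop : ∀ p : Pt, ∀ k < H, IsUnitStep (p + h k) (p + h (k + 1)) := by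
    intro p k hk
    have := hh k hk
    simp only [IsUnitStep, Prod.fst_add, Prod.snd_add] at this ⊢; omega
  intro L
  induction L with
  | zero =>
    intro _ _
    rw [dwnd_append, dwnd_append, dwnd_append, dwnd_bwdPiece_eq_neg_ST _ 0 H F (fun k hk => by simpa using hhop (ζ 0) k hk)]
    set X := dwnd (fwdPiece (fun k => ζ 0 + h k) 0 H) F
    simp [fwdPiece, bwdPiece]
  | succ L ih =>
    intro hζ hfar
    have ih' := ih (fun i hi => hζ i (by omega)) (fun i hi => hfar i (by omega))
    -- the elementary closed chain at step `L`
    set Q : List (Pt × Pt) := [(ζ L, ζ (L + 1))] ++ fwdPiece (fun k => ζ (L + 1) + h k) 0 H ++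
      [(ζ (L + 1) + h H, ζ L + h H)] ++ bwdPiece (fun k => ζ L + h k) 0 H with hQ
    have hQu : ∀ d ∈ Q, IsUnitStep d.1 d.2 ∨ d.1 = d.2 := by
      intro d hd
      simp only [hQ, List.mem_append, List.mem_singleton] at hd
      rcases hd with ((rfl | hd) | rfl) | hd
      · exact Or.inl (hζ L (by omega))
      · obtain ⟨k, hk, rfl⟩ := mem_fwdPiece_SR hd; exact Or.inl (by simpa using hhop (ζ (L + 1)) k hk)
      · left
        have := hζ L (by omega)
        simp only [IsUnitStep, Prod.fst_add, Prod.snd_add] at this ⊢; omega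
      · obtain ⟨k, hk, rfl⟩ := mem_bwdPiece_SR hd; exact Or.inl (by simpa using (hhop (ζ L) k hk).symm)
    have hQK : ∀ g : Pt → ℤ, (Q.map fun d => g d.2 - g d.1).sum = 0 := by
      intro g
      simp only [hQ, List.map_append, List.sum_append, List.map_cons, List.map_nil, List.sum_cons, List.sum_nil,
        fwdPiece_boundary_SR, bwdPiece_boundary_SR, zero_add, h0, add_zero]
      ring
    have hQbox : ∀ d ∈ Q, |d.1.1 - (ζ L).1| ≤ H + 1 ∧ |d.1.2 - (ζ L).2| ≤ H + 1 := by
      intro d hd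
      have hs := hζ L (by omega)
      simp only [hQ, List.mem_append, List.mem_singleton] at hd
      rcases hd with ((rfl | hd) | rfl) | hd
      · constructor <;> simp <;> positivity
      · obtain ⟨k, hk, rfl⟩ := mem_fwdPiece_SR hd
        obtain ⟨b1, b2⟩ := hb k hk.le
        simp only [IsUnitStep] at hs
        simp only [zero_add, Prod.fst_add, Prod.snd_add]
        rw [abs_le] at b1 b2; constructor <;> rw [abs_le] <;> omega
      · obtain ⟨b1, b2⟩ := hb H le_rfl
        simp only [IsUnitStep] at hs
        simp only [Prod.fst_add, Prod.snd_add]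
        rw [abs_le] at b1 b2; constructor <;> rw [abs_le] <;> omega
      · obtain ⟨k, hk, rfl⟩ := mem_bwdPiece_SR hd
        obtain ⟨b1, b2⟩ := hb (k + 1) (by omega)
        simp only [zero_add, Prod.fst_add, Prod.snd_add]
        rw [abs_le] at b1 b2; constructor <;> rw [abs_le] <;> push_cast at b1 b2 ⊢ <;> omega
    have hQ0 : dwnd Q F = 0 := by
      refine dwnd_eq_zero_of_box_ST Q F (ζ L) (H + 1) hQu hQK hQbox ?_
      rcases hfar L (by omega) with h' | h' <;> [left; right] <;> omega
    -- the ribbon of length `L + 1` is the ribbon of length `L` plus `Q`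
    have e1 : dwnd (bwdPiece (fun k => ζ L + h k) 0 H) F = -dwnd (fwdPiece (fun k => ζ L + h k) 0 H) F :=
      dwnd_bwdPiece_eq_neg_ST _ 0 H F (fun k hk => by simpa using hhop (ζ L) k hk)
    rw [fwdPiece_succ_ST, bwdPiece_succ_ST]
    simp only [dwnd_append, dwnd_cons, dwnd_nil, add_zero, zero_add] at ih' ⊢
    simp only [hQ, dwnd_append, dwnd_cons, dwnd_nil, add_zero] at hQ0
    linarith

/-- **The ribbon lemma** (registered helper `openArc_ribbon_ST` of stmt-CriticalPhenomena-11387; explicit form of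
`dwnd_ribbon_ST` with the winding number written as sums). -/
theorem openArc_ribbon_ST : ∀ (ζ h : ℕ → MedialTrail.Pt) (H L : ℕ) (F : MedialTrail.Pt), h 0 = 0 → (∀ k < H, MedialTrail.IsUnitStep (h k) (h (k + 1))) → (∀ i < L, MedialTrail.IsUnitStep (ζ i) (ζ (i + 1))) → (∀ i ≤ L, (H : ℤ) + 3 ≤ |F.1 - (ζ i).1| ∨ (H : ℤ) + 3 ≤ |F.2 - (ζ i).2|) → (∑ i ∈ Finset.range L, MedialTrail.dartWnd (ζ i, ζ (i + 1)) F) + (∑ k ∈ Finset.range H, MedialTrail.dartWnd (ζ L + h k, ζ L + h (k + 1)) F) - (∑ i ∈ Finset.range L, MedialTrail.dartWnd (ζ i + h H, ζ (i + 1) + h H) F) - (∑ k ∈ Finset.range H, MedialTrail.dartWnd (ζ 0 + h k, ζ 0 + h (k + 1)) F) = 0 := by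
  intro ζ h H L F h0 hh hζ hfar
  have key := dwnd_ribbon_ST ζ h H F h0 hh L hζ hfar
  have hhop : ∀ p : Pt, ∀ k < H, IsUnitStep (p + h k) (p + h (k + 1)) := by
    intro p k hk
    have := hh k hk
    simp only [IsUnitStep, Prod.fst_add, Prod.snd_add] at this ⊢; omega
  have hζ' : ∀ k < L, IsUnitStep (ζ (0 + k) + h H) (ζ (0 + k + 1) + h H) := by
    intro k hk
    have := hζ k hk
    rw [zero_add]
    simp only [IsUnitStep, Prod.fst_add, Prod.snd_add] at this ⊢; omega
  rw [dwnd_append, dwnd_append, dwnd_append, dwnd_bwdPiece_SR _ 0 L F hζ',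
    dwnd_bwdPiece_SR _ 0 H F (fun k hk => by simpa using hhop (ζ 0) k hk), dwnd_fwdPiece_SR, dwnd_fwdPiece_SR] at key
  simp only [zero_add] at key
  linarith

end Summit.CriticalPhenomena.CardyFormulaZ2.Cruxes.EdgePrecompact.QkzStripBoundaryArm
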